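import Summits.SmoothPoincare4.SmoothPoincare4.Theses.WeakReductionDescent
import Summits.SmoothPoincare4.SmoothPoincare4.Theorems.WeakReductionDescentWeakReductionReducesStubLoopDichotomyFromFiveAux1

/-!
# Crux `WeakReductionReduces` (stmt-SmoothPoincare4-17908), line `loop_dichotomy`, stub CORE₅⁺
# (`stub_loopDichotomyFromFiveCorePos`) — normal form `k₁ ≥ k₂` of the type (proved glue)

Stub CORE₅⁺ of the line (the irreducible fixed-label core of the trichotomy at rungs `g ≥ 5`, non-MSZ
types `Σ kᵢ = g`, all `kᵢ + 2 ≤ g`, with `1 ≤ k₀` — the structural lemma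
`helper_one_le_kZero_of_doublyCompressing` having removed the vacuous `k₀ = 0` family,
…StubLoopDichotomyFromFiveCoreAux1/Aux2): this file PROVES that it follows from its restriction to
the types with `k 2 ≤ k 1`, exactly as `…StubLoopDichotomyFourCoreAux1.lean` does at genus 4.  The
transposition `(1 2)` of the sectors fixes `H₀ = T 1 ∩ T 2` and swaps `H₁`, `H₂`, so it preserves the
fixed-label weak reduction (`c` compressing in `H₀`, `c′` in both `H₁` and `H₂`), the type hypotheses
(`Σ kᵢ = g`, `kᵢ + 2 ≤ g`, `1 ≤ k₀`), irreducibility (`isReducible_comp_perm`) and the two exits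
(which mention `M` only) — `IsGKTrisection.comp_perm`,
`Literature.Barriers.SmoothPoincare4.Trisection.*_comp_perm`, all PROVED.

Registered helper `helper_loopDichotomyFromFiveCorePos_of_normalised : CORE₅ⁿ → CORE₅⁺` (stub-add on
the crux; lands `--supports stmt-SmoothPoincare4-17908`).  Pure logic over PROVED tree theorems.

## References

* R. Aranda, A. Zupan, *Manifolds with weakly reducible genus-three trisections are standard*,
  arXiv:2503.04607 (2025): §2 (p. 6: the labels are fixed by a symmetry of the sectors). [ArandaZupan2025]
* D. Gay, R. Kirby, *Trisecting 4-manifolds*, Geom. Topol. 20 (2016), Def. 1. [GayKirby2016]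
-/

-- the registered namespace `Summit.SmoothPoincare4.SmoothPoincare4.Theorems…` repeats a component
set_option linter.dupNamespace false

noncomputable section

open scoped Manifold ContDiff Topology ContinuousMap
open Set
open Literature.Topology.FourManifolds Literature.Topology.FourManifolds.Trisection

namespace Summit.SmoothPoincare4.SmoothPoincare4.Theorems.WeakReductionReduces.LoopDichotomy

/-- **`helper_loopDichotomyFromFiveCorePos_of_normalised` : CORE₅ⁿ → CORE₅⁺** (registered helper of
crux stmt-SmoothPoincare4-17908, line `loop_dichotomy`, stub `stub_loopDichotomyFromFiveCorePos`).
If `k 2 ≤ k 1` apply the normalised core; otherwise relabel the sectors by the transposition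
`(1 2)`, which fixes `H₀`, swaps `H₁` and `H₂`, and preserves every hypothesis and both exits.
[cite: ArandaZupan2025, §2 (p. 6)] [cite: GayKirby2016, Def. 1] -/
theorem helper_loopDichotomyFromFiveCorePos_of_normalised :
    (∀ (M : Type) [TopologicalSpace M] [T2Space M] [SecondCountableTopology M] [ChartedSpace (EuclideanSpace ℝ (Fin 4)) M] [IsManifold (𝓡 4) ((⊤ : ℕ∞) : WithTop ℕ∞) M], (M ≃ₕ (Metric.sphere (0 : EuclideanSpace ℝ (Fin 5)) 1)) → ∀ (g : ℕ) (k : Fin 3 → ℕ) (T : Fin 3 → Set M), Literature.Topology.FourManifolds.IsGKTrisection M g k T → 5 ≤ g → k 0 + k 1 + k 2 = g → (∀ i, k i + 2 ≤ g) → 1 ≤ k 0 → k 2 ≤ k 1 → (∃ c c' : Set M, Literature.Topology.FourManifolds.Trisection.IsCurve T c ∧ Literature.Topology.FourManifolds.Trisection.IsCurve T c' ∧ Disjoint c c' ∧ Literature.Topology.FourManifolds.Trisection.IsNonSeparating T c ∧ Literature.Topology.FourManifolds.Trisection.IsNonSeparating T c' ∧ Literature.Topology.FourManifolds.Trisection.BoundsDisc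 T (Literature.Topology.FourManifolds.Trisection.spineHandlebody T 0) c ∧ Literature.Topology.FourManifolds.Trisection.BoundsDisc T (Literature.Topology.FourManifolds.Trisection.spineHandlebody T 1) c' ∧ Literature.Topology.FourManifolds.Trisection.BoundsDisc T (Literature.Topology.FourManifolds.Trisection.spineHandlebody T 2) c') → ¬ Literature.Topology.FourManifolds.Trisection.IsReducible T → (∃ (g₁ : ℕ) (k₁ : Fin 3 → ℕ) (T₁ : Fin 3 → Set M), g₁ < g ∧ Literature.Topology.FourManifolds.IsGKTrisection M g₁ k₁ T₁) ∨ (∃ (X : Type) (_ : TopologicalSpace X) (_ : T2Space X) (_ : SecondCountableTopology X) (_ : ChartedSpace (EuclideanSpace ℝ (Fin 4)) X) (_ : IsManifold (𝓡 4) ((⊤ : ℕ∞) : WithTop ℕ∞) X) (g' : ℕ) (k' : Fin 3 → ℕ) (T' : Fin 3 → Set X) (ℓ : (Metric.sphere (0 : EuclideanSpace ℝ (Fin 2)) 1) → X), g' < g ∧ Literature.Topology.FourManifolds.IsGKTrisection X g' k' T' ∧ Manifold.IsSmoothEmbedding (𝓡 1) (𝓡 4) ((⊤ : ℕ∞) :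 WithTop ℕ∞) ℓ ∧ Literature.Topology.FourManifolds.IsCircleSurgery (𝓡 4) (𝓡 4) X M ℓ)) → ∀ (M : Type) [TopologicalSpace M] [T2Space M] [SecondCountableTopology M] [ChartedSpace (EuclideanSpace ℝ (Fin 4)) M] [IsManifold (𝓡 4) ((⊤ : ℕ∞) : WithTop ℕ∞) M], (M ≃ₕ (Metric.sphere (0 : EuclideanSpace ℝ (Fin 5)) 1)) → ∀ (g : ℕ) (k : Fin 3 → ℕ) (T : Fin 3 → Set M), Literature.Topology.FourManifolds.IsGKTrisection M g k T → 5 ≤ g → k 0 + k 1 + k 2 = g → (∀ i, k i + 2 ≤ g) → 1 ≤ k 0 → (∃ c c' : Set M, Literature.Topology.FourManifolds.Trisection.IsCurve T c ∧ Literature.Topology.FourManifolds.Trisection.IsCurve T c' ∧ Disjoint c c' ∧ Literature.Topology.FourManifolds.Trisection.IsNonSeparating T c ∧ Literature.Topology.FourManifolds.Trisection.IsNonSeparating T c' ∧ Literature.Topology.FourManifolds.Trisection.BoundsDisc T (Literature.Topology.FourManifolds.Trisection.spineHandlebody T 0) c ∧ Literature.Topology.FourManifolds.Trisection.BoundsDisc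 T (Literature.Topology.FourManifolds.Trisection.spineHandlebody T 1) c' ∧ Literature.Topology.FourManifolds.Trisection.BoundsDisc T (Literature.Topology.FourManifolds.Trisection.spineHandlebody T 2) c') → ¬ Literature.Topology.FourManifolds.Trisection.IsReducible T → (∃ (g₁ : ℕ) (k₁ : Fin 3 → ℕ) (T₁ : Fin 3 → Set M), g₁ < g ∧ Literature.Topology.FourManifolds.IsGKTrisection M g₁ k₁ T₁) ∨ (∃ (X : Type) (_ : TopologicalSpace X) (_ : T2Space X) (_ : SecondCountableTopology X) (_ : ChartedSpace (EuclideanSpace ℝ (Fin 4)) X) (_ : IsManifold (𝓡 4) ((⊤ : ℕ∞) : WithTop ℕ∞) X) (g' : ℕ) (k' : Fin 3 → ℕ) (T' : Fin 3 → Set X) (ℓ : (Metric.sphere (0 : EuclideanSpace ℝ (Fin 2)) 1) → X), g' < g ∧ Literature.Topology.FourManifolds.IsGKTrisection X g' k' T' ∧ Manifold.IsSmoothEmbedding (𝓡 1) (𝓡 4) ((⊤ : ℕ∞) : WithTop ℕ∞) ℓ ∧ Literature.Topology.FourManifolds.IsCircleSurgery (𝓡 4) (𝓡 4) X M ℓ)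 := by
  intro hcore M _ _ _ _ _ e g k T hT hg hsum hk hk0 hwr hirr
  rcases le_or_gt (k 2) (k 1) with h21 | h12
  · exact hcore M e g k T hT hg hsum hk hk0 h21 hwr hirr
  · obtain ⟨c, c', hc, hc', hd, hn, hn', hb0, hb1, hb2⟩ := hwr
    set σ : Equiv.Perm (Fin 3) := Equiv.swap (1 : Fin 3) 2 with hσ
    have hσ0 : σ 0 = 0 := by rw [hσ]; decide
    have hσ1 : σ 1 = 2 := by rw [hσ]; decide
    have hσ2 : σ 2 = 1 := by rw [hσ]; decide
    have hT' : IsGKTrisection M g (k ∘ σ) (T ∘ σ) := hT.comp_perm σ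
    have hsum' : (k ∘ σ) 0 + (k ∘ σ) 1 + (k ∘ σ) 2 = g := by
      simp only [Function.comp_apply, hσ0, hσ1, hσ2]; omega
    have hk' : ∀ i, (k ∘ σ) i + 2 ≤ g := fun i => hk _
    have hk0' : 1 ≤ (k ∘ σ) 0 := by simp only [Function.comp_apply, hσ0]; exact hk0
    have h21' : (k ∘ σ) 2 ≤ (k ∘ σ) 1 := by
      simp only [Function.comp_apply, hσ1, hσ2]; omega
    have hirr' : ¬ IsReducible (T ∘ σ) := fun h => hirr ((isReducible_comp_perm T σ).1 h)
    have hwr' : ∃ c c' : Set M, IsCurve (T ∘ σ) c ∧ IsCurve (T ∘ σ) c' ∧ Disjoint c c' ∧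
        IsNonSeparating (T ∘ σ) c ∧ IsNonSeparating (T ∘ σ) c' ∧
        BoundsDisc (T ∘ σ) (spineHandlebody (T ∘ σ) 0) c ∧
        BoundsDisc (T ∘ σ) (spineHandlebody (T ∘ σ) 1) c' ∧
        BoundsDisc (T ∘ σ) (spineHandlebody (T ∘ σ) 2) c' := by
      refine ⟨c, c', (Literature.Barriers.SmoothPoincare4.Trisection.isCurve_comp_perm T σ c).2 hc,
        (Literature.Barriers.SmoothPoincare4.Trisection.isCurve_comp_perm T σ c').2 hc', hd,
        (Literature.Barriers.SmoothPoincare4.Trisection.isNonSeparating_comp_perm T σ c).2 hn,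
        (Literature.Barriers.SmoothPoincare4.Trisection.isNonSeparating_comp_perm T σ c').2 hn',
        ?_, ?_, ?_⟩
      · rw [Literature.Barriers.SmoothPoincare4.Trisection.spineHandlebody_comp_perm,
          Literature.Barriers.SmoothPoincare4.Trisection.boundsDisc_comp_perm, hσ0]
        exact hb0
      · rw [Literature.Barriers.SmoothPoincare4.Trisection.spineHandlebody_comp_perm,
          Literature.Barriers.SmoothPoincare4.Trisection.boundsDisc_comp_perm, hσ1]
        exact hb2
      · rw [Literature.Barriers.SmoothPoincare4.Trisection.spineHandlebody_comp_perm,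
          Literature.Barriers.SmoothPoincare4.Trisection.boundsDisc_comp_perm, hσ2]
        exact hb1
    exact hcore M e g _ _ hT' hg hsum' hk' hk0' h21' hwr' hirr'

end Summit.SmoothPoincare4.SmoothPoincare4.Theorems.WeakReductionReduces.LoopDichotomy

end
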